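import Literature.NumberTheory.EllipticCurves.Phi64
import Literature.NumberTheory.EllipticCurves.ModularSymbols
import HarnessLib

/-!
# `φ₆₄(z + 1/4) = i φ₆₄(z)` and `{∞, r + 1/4}_{φ₆₄} = i {∞, r}_{φ₆₄}`

[[cite: Tunnell1983Congruent, p. 327]] (the newform of level `64` attached to `E₂ : y² = x³ - 4x`
has `q`-expansion supported on exponents `≡ 1 (mod 4)`) — for `φ₆₄ = ½ Θ' θ₄` (`Phi64`) the
exponents of `Θ'` are odd squares `≡ 1 (mod 8)` and those of `θ₄(z) = θ(4z)` are `≡ 0 (mod 4)`,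
whence `φ₆₄(z + 1/4) = i φ₆₄(z)` and, integrating along vertical rays, the modular symbols of
`φ₆₄` at cusps differing by `1/4` differ by the factor `i`.  We PROVE `thetaChi_vadd_quarter`,
`thetaMul_four_vadd_quarter`, **`phi64_vadd_quarter`** and **`modularSymbol_phi64_add_quarter`**
(used to turn the translated Birch sum `∑ χ_D(a) {1/4, a/D + 1/4}` of the diagonal Shintani
coefficient into `i ∑ χ_D(a) {∞, a/D}`).

No named facts, no new definitions.
-/

noncomputable section

open scoped MatrixGroups ModularForm
open UpperHalfPlane hiding I
open Complex Filter Topology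
open Literature.NumberTheory.EllipticCurves.ModularForms
open Literature.NumberTheory.EllipticCurves.Tunnell1983

namespace Literature.NumberTheory.EllipticCurves.Shintani

/-- `Θ'(z + 1/4) = i Θ'(z)`: the exponents `n²`, `n` odd, are `≡ 1 (mod 4)` (even `n` have
`χ₋₄(n) = 0`). [folklore] -/
theorem thetaChi_vadd_quarter (z : ℍ) : thetaChi (((1 / 4 : ℝ)) +ᵥ z) = I * thetaChi z := by
  rw [thetaChi, thetaChi, ← tsum_mul_left]
  refine tsum_congr fun n ↦ ?_
  rw [thetaChiTerm, thetaChiTerm, UpperHalfPlane.coe_vadd]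
  by_cases hn : Odd n
  · -- `e(n² (z + 1/4)) = e(n²/4) e(n² z)` and `e(n²/4) = i` for odd `n`
    obtain ⟨k, hk⟩ := hn
    have hsq : (n : ℂ) ^ 2 = 4 * ((k ^ 2 + k : ℤ) : ℂ) + 1 := by
      rw [hk]; push_cast; ring
    have hexp : cexp (2 * Real.pi * I * n ^ 2 * ((((1 / 4 : ℝ)) : ℂ) + (z : ℂ))) =
        I * cexp (2 * Real.pi * I * n ^ 2 * (z : ℂ)) := by
      rw [show 2 * Real.pi * I * n ^ 2 * ((((1 / 4 : ℝ)) : ℂ) + (z : ℂ)) =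
          (2 * Real.pi * I * ((k ^ 2 + k : ℤ) : ℂ) + Real.pi / 2 * I) + 2 * Real.pi * I * n ^ 2 * (z : ℂ) by
        rw [hsq]; push_cast; ring, Complex.exp_add, Complex.exp_add]
      have h1 : cexp (2 * Real.pi * I * ((k ^ 2 + k : ℤ) : ℂ)) = 1 := by
        rw [show 2 * Real.pi * I * ((k ^ 2 + k : ℤ) : ℂ) = ((k ^ 2 + k : ℤ)) * (2 * Real.pi * I) by ring]
        exact Complex.exp_int_mul_two_pi_mul_I _
      rw [h1, one_mul, Complex.exp_pi_div_two_mul_I]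
    rw [hexp]; ring
  · have h0 : chiM4 n = 0 := by
      rw [chiM4, ZMod.χ₄_int_eq_if_mod_four]
      have : n % 2 = 0 := Int.even_iff.mp (Int.not_odd_iff_even.mp hn)
      simp [this]
    rw [h0]; simp

/-- `θ(4(z + 1/4)) = θ(4z)`. [folklore] -/
theorem thetaMul_four_vadd_quarter (z : ℍ) : thetaMul 4 (((1 / 4 : ℝ)) +ᵥ z) = thetaMul 4 z := by
  rw [thetaMul, thetaMul]
  refine tsum_congr fun m ↦ ?_
  rw [UpperHalfPlane.coe_vadd]
  have : 2 * Real.pi * Complex.I * ((((4 : ℕ) * m ^ 2 : ℤ)) : ℂ) * ((((1 / 4 : ℝ)) : ℂ) + (z : ℂ)) =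
      ((m ^ 2 : ℤ) : ℂ) * (2 * Real.pi * Complex.I) + 2 * Real.pi * Complex.I * ((((4 : ℕ) * m ^ 2 : ℤ)) : ℂ) * (z : ℂ) := by
    push_cast; ring
  rw [this, Complex.exp_add, Complex.exp_int_mul_two_pi_mul_I, one_mul]

/-- **`φ₆₄(z + 1/4) = i φ₆₄(z)`** (the exponents of `φ₆₄ = ½ Θ' θ₄` are `≡ 1 (mod 4)`).
[cite: Tunnell1983Congruent, p. 327 (the newform of level 64)] -/
theorem phi64_vadd_quarter (z : ℍ) : phi64 (((1 / 4 : ℝ)) +ᵥ z) = I * phi64 z := by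
  rw [phi64, phi64, thetaChi_vadd_quarter, thetaMul_four_vadd_quarter]; ring

/-- **`{∞, r + 1/4}_{φ₆₄} = i · {∞, r}_{φ₆₄}`** for the cusp form `φ₆₄`. [folklore] -/
theorem modularSymbol_phi64_add_quarter (r : ℚ) :
    modularSymbol phi64CuspForm (r + 1 / 4) = I * modularSymbol phi64CuspForm r := by
  rw [modularSymbol, modularSymbol]
  have key : ∫ t in Set.Ioi (0 : ℝ), (phi64CuspForm : ℍ → ℂ) (UpperHalfPlane.ofComplex ((((r + 1 / 4 : ℚ) : ℂ)) + t * I)) =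
      ∫ t in Set.Ioi (0 : ℝ), I * (phi64CuspForm : ℍ → ℂ) (UpperHalfPlane.ofComplex (((r : ℂ)) + t * I)) := by
    refine MeasureTheory.setIntegral_congr_fun (measurableSet_Ioi : MeasurableSet (Set.Ioi (0 : ℝ))) fun t ht ↦ ?_
    have hcoe : ∀ z : ℍ, (phi64CuspForm : ℍ → ℂ) z = phi64 z := fun z ↦ rfl
    have ht : 0 < t := ht
    have him : 0 < (((r : ℂ)) + t * I).im := by simpa using ht
    have him' : 0 < ((((r + 1 / 4 : ℚ) : ℂ)) + t * I).im := by simpa using ht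
    have hpt : UpperHalfPlane.ofComplex ((((r + 1 / 4 : ℚ) : ℂ)) + t * I) =
        ((1 / 4 : ℝ)) +ᵥ UpperHalfPlane.ofComplex (((r : ℂ)) + t * I) := by
      apply UpperHalfPlane.ext
      rw [UpperHalfPlane.ofComplex_apply_of_im_pos him', UpperHalfPlane.coe_vadd,
        UpperHalfPlane.ofComplex_apply_of_im_pos him]
      push_cast; ring
    rw [hcoe, hcoe, hpt, phi64_vadd_quarter]
  rw [key, MeasureTheory.integral_const_mul]
  ring

end Literature.NumberTheory.EllipticCurves.Shintani
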